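import Summits.ValiantsHypothesis.ValiantsHypothesis.Theses.UlrichPadded
import Literature.Computability.AlgebraicComplexity.MignonRessayreBound

/-!
# Route UlrichPadded — item `NoGlobalSplitting`

`per_n` (`n ≥ 3`) is not the determinant of an `n × n` matrix of affine linear forms over `ℂ`:
an immediate consequence of the (proved, in-tree) Mignon–Ressayre bound
`Literature.Computability.AlgebraicComplexity.sq_le_two_mul_of_hasDetRepr_perPoly`
(`HasDetRepr per_{m+3} M → (m+3)² ≤ 2M`, Mignon–Ressayre 2004, Thm. 1.1), since `n² > 2n` for
`n ≥ 3`. In the route this rules out a Kerner–Vinnikov splitting of the padded linear matrix into an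
`x₀`-block `⊕` a `per`-block of size `n`.
-/

namespace Summit.ValiantsHypothesis.Theorems

open Literature.Computability.AlgebraicComplexity

/-- **No global splitting** (route UlrichPadded, item `NoGlobalSplitting`): for every `n ≥ 3`,
`per_n` over `ℂ` has no affine determinantal representation of size `n`. Proof: by the in-tree
Mignon–Ressayre inequality `sq_le_two_mul_of_hasDetRepr_perPoly`, a size-`n` representation of
`per_n` with `n = m + 3` would give `(m+3)² ≤ 2(m+3)`, which is absurd. -/
theorem noGlobalSplitting_proof :
    Summit.ValiantsHypothesis.ValiantsHypothesis.Theses.UlrichPadded.NoGlobalSplitting := by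
  unfold Summit.ValiantsHypothesis.ValiantsHypothesis.Theses.UlrichPadded.NoGlobalSplitting
  intro n hn h
  obtain ⟨m, rfl⟩ : ∃ m, n = m + 3 := ⟨n - 3, by omega⟩
  have hsq : (m + 3) ^ 2 ≤ 2 * (m + 3) := sq_le_two_mul_of_hasDetRepr_perPoly h
  nlinarith [hsq]

end Summit.ValiantsHypothesis.Theorems
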